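import Summits.QuantumFields.BalabanUV.T4Continuum.Spine.NE2.RegularGaugeFieldWave
import Summits.QuantumFields.BalabanUV.T4Continuum.Spine.NE2.DeltaPrimeFieldStrength

/-!
# T⁴ programme, spine node NE2 (U1a) — THE CURVED WITNESS, PART 2: FIELD STRENGTH OF THE TRANSVERSE `U(1)`-PHASE WAVE AND ITS NE3-TYPE TWO-LEVEL CONSISTENCY
# (cell `pub-balaban-gaps`, seat ne2 gen 3, file 5b; companion of `Spine/NE2/RegularGaugeFieldWave`; the END instance is part 3, `Spine/NE2/RegularGaugeFieldWaveEnd`)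

§1: the plaquette holonomy of the wave `cwave` is the scalar unitary `exp(i·σ_{μν}·D_k(x))·1` with `D_k(x) = (θ/c_k)·(cos(α_x + h_k) − cos α_x)` the one-step difference of the
profile (`α_x = 2π·val(x_{μ₀})/(c_k M_{μ₀})`, `h_k = 2π/(c_k M_{μ₀})`) and `σ_{μν} = [ν = ν₀][μ = μ₀] − [μ = ν₀][ν = μ₀] ∈ {−1, 0, 1}` (**`pang_eq`**, **`plaqHol_cwave`**), so the
lattice field strength is `F_k = c_k²(e^{iσD_k} − 1)·1` (**`Fstr_cwave`**).  §2: the 1-D estimate behind the two-level consistency — at each level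
`c_k²(e^{iσD_k} − 1) = −iσθ(2π/M_{μ₀})·sin α + O((|θ| + θ²)/c_k)` (**`norm_levsq_phase_add_main_le`**: second-order Taylor of `exp` (`Complex.norm_exp_sub_one_sub_id_le`) and of
`cos` (`RegularGaugeFieldWave.abs_cos_add_sub_cos_add_mul_sin_le`)), the block parent moves the angle by less than one coarse step (**`abs_angle_sub_angle_par_le`**, because
the blocks nest: `val(par y) = ⌊val y/L⌋`), hence **`Fstr_cwave_consistent`**:
  `‖F_{k+1}(μ,ν,y) − F_k(μ,ν,par y)‖ ≤ 4π²(3|θ| + 2θ²)/M_{μ₀}² · c_k⁻¹`  for `|θ| ≤ 1`, `M_{μ₀} ≥ 7`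
— the NE3-type field-strength consistency binder (Fc) of `AdjointFieldRegularity.balaban326_rate_of_regularGaugeField`, DISCHARGED for the wave.
HONEST FRAMING (T4-DAG p. 1).  A TOY member of the data class (OURS): elementary trigonometry on the tree's finite tori; GLOBAL small field; asserts NOTHING about Bałaban's
minimisers or node NE3 away from this family; NE2 (U1a) NOT PROVED; spine PROVED 0/9 unchanged; NOT continuum YM / infinite volume / mass gap / Clay.  HONEST DEPENDENCY:
continuum YM on T⁴ ⇐ BetaPertH ∧ nine spine estimates (0/9 proved); BetaPertH ⇐ (D1) ∧ (D4) ∧ CAP+tail; G-an2-4 gates asym, D1 and NE2/3/4.  No `sorry`; defs: the sign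
`sgn2` and the step `Dstep` only.
-/

noncomputable section

open scoped BigOperators ComplexConjugate Matrix Real

namespace Summit.QuantumFields.BalabanUV.T4Continuum.NE2.RegularGaugeFieldWaveCurvature

open scoped Kronecker Matrix.Norms.L2Operator
open Literature.MathematicalPhysics.QuantumFieldTheory.Balaban1983to89.B5Prop11Plancherel (Tor fine unitVec Cst Cst_nonneg)
open Literature.MathematicalPhysics.QuantumFieldTheory.Balaban1983to89.B5G183RateUnitTower (lev lev_neZero)
open Literature.MathematicalPhysics.QuantumFieldTheory.Balaban1983to89.B9AdOrthogonal (R form)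
open Literature.MathematicalPhysics.QuantumFieldTheory.Balaban1983to89.T4EtaRateMin (LocalRate)
open Summit.QuantumFields.BalabanUV.T4Continuum
open Summit.QuantumFields.BalabanUV.T4Continuum.BalabanAveragedTowerUnit (idx Qlev one_le_lev' lev_succ')
open Summit.QuantumFields.BalabanUV.T4Continuum.BalabanAveragedTowerModes (par val_par)
open Summit.QuantumFields.BalabanUV.T4Continuum.CovariantAveragingTower (TowerLimitRate)
open Summit.QuantumFields.BalabanUV.T4Continuum.CovariantBlockAveraging (QcovLev)
open Summit.QuantumFields.BalabanUV.T4Continuum.BackgroundResolventTower (Cpert)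
open Summit.QuantumFields.BalabanUV.T4Continuum.KingPairingPlantedLaw (CJ)
open Summit.QuantumFields.BalabanUV.T4Continuum.NE2FromNE3 (bgReadings)
open Summit.QuantumFields.BalabanUV.T4Continuum.RegularBackgroundTower (betaNE3 lev_pos)
open Summit.QuantumFields.BalabanUV.T4Continuum.HolonomyTowerRegular (RegularSites regClass₂)
open Summit.QuantumFields.BalabanUV.T4Continuum.LatticeCosineProfile (cang abs_cang_le cang_add abs_cang_add_one_sub_le)
open Summit.QuantumFields.BalabanUV.T4Continuum.GaugeTermScalarData (QuT)
open Summit.QuantumFields.BalabanUV.T4Continuum.RegularSiteTransporters (siteT)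
open Summit.QuantumFields.BalabanUV.T4Continuum.NestedContourTransport (theta0)
open Summit.QuantumFields.BalabanUV.T4Continuum.GramPerturbationLaw (C2gram)
open Summit.QuantumFields.BalabanUV.T4Continuum.NE2BalabanGauge (liftR)
open Summit.QuantumFields.BalabanUV.T4Continuum.NE2BalabanLayerSharp (kappaBs C2Bs)
open Summit.QuantumFields.BalabanUV.T4Continuum.NE2BalabanWiring (epsR CdeltaR)
open Summit.QuantumFields.BalabanUV.T4Continuum.NE2BalabanFinal (kappa4F C4F)
open Summit.QuantumFields.BalabanUV.T4Continuum.NE2BalabanThreshold (etaStar)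
open Summit.QuantumFields.BalabanUV.T4Continuum.GaugeTermSandwichBound (projP)
open Summit.QuantumFields.BalabanUV.T4Continuum.GaugeTermLayer (Gop)
open Summit.QuantumFields.BalabanUV.Beta.AdjointCarrierWiring (adMat adMat_apply adMat_one)
open Summit.QuantumFields.BalabanUV.Beta.AdjointCarrierWiringEnd (CompFamily)
open Summit.QuantumFields.BalabanUV.Beta.ThinLoopHolonomy (cpxHom)
open Summit.QuantumFields.BalabanUV.T4Continuum.NE2.AdjointFieldInstance (adRep adRep_apply)
open Summit.QuantumFields.BalabanUV.T4Continuum.NE2.DeltaPrimeOperator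
open Summit.QuantumFields.BalabanUV.T4Continuum.NE2.DictionaryB0 (principalB9)
open Summit.QuantumFields.BalabanUV.T4Continuum.NE2.DeltaPrimeFieldStrength (Fstr symL brkL)
open Summit.QuantumFields.BalabanUV.T4Continuum.NE2.RegularGaugeFieldWave

variable {n : Type} [Fintype n] [DecidableEq n] {d : ℕ} {ι : Type} [Fintype ι] [DecidableEq ι]

/-! ## §1 The plaquette holonomy and the field strength of the wave -/

section Plaquette

variable (L : ℕ) [NeZero L] (M : Fin d → ℕ) [hM : ∀ μ, NeZero (M μ)] (θ : ℝ) (ν₀ μ₀ : Fin d)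

/-- the inverse of a scalar matrix `e^{it}·1` is `e^{−it}·1`. [folklore] -/
theorem cexp_smul_one_inv (t : ℝ) : (Complex.exp (Complex.I * t) • (1 : Matrix n n ℂ))⁻¹ = Complex.exp (-(Complex.I * t)) • (1 : Matrix n n ℂ) := by
  refine Matrix.inv_eq_left_inv ?_
  rw [Matrix.smul_mul, Matrix.one_mul, smul_smul, ← Complex.exp_add, neg_add_cancel, Complex.exp_zero, one_smul]

/-- the sign `σ_{μν} = [ν = ν₀][μ = μ₀] − [μ = ν₀][ν = μ₀]` with which the one-step difference of the profile enters the `(μ, ν)`-plaquette phase. [folklore] -/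
def sgn2 (μ ν : Fin d) : ℝ := (if ν = ν₀ ∧ μ = μ₀ then 1 else 0) - (if μ = ν₀ ∧ ν = μ₀ then 1 else 0)

omit hM in
/-- `|σ_{μν}| ≤ 1`. [folklore] -/
theorem abs_sgn2_le (μ ν : Fin d) : |sgn2 ν₀ μ₀ μ ν| ≤ 1 := by
  unfold sgn2; split_ifs <;> norm_num

/-- the one-step difference of the profile along `μ₀`: `D_k(x) = (θ/c_k)·(c(x_{μ₀} + 1) − c(x_{μ₀}))`. [folklore] -/
def Dstep (k : ℕ) (x : Tor (fine (lev L k) M)) : ℝ :=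
  θ / (lev L k : ℕ) * (cang (fine (lev L k) M μ₀) (x μ₀ + 1) - cang (fine (lev L k) M μ₀) (x μ₀))

omit [NeZero L] hM in
/-- **THE PLAQUETTE PHASE OF THE WAVE**: `t(μ,x) + t(ν,x+e_μ) − t(μ,x+e_ν) − t(ν,x) = σ_{μν}·D_k(x)`. [folklore] -/
theorem pang_eq (k : ℕ) (μ ν : Fin d) (x : Tor (fine (lev L k) M)) :
    tw L M θ ν₀ μ₀ k μ x + tw L M θ ν₀ μ₀ k ν (x + unitVec _ μ) - tw L M θ ν₀ μ₀ k μ (x + unitVec _ ν) - tw L M θ ν₀ μ₀ k ν x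
      = sgn2 ν₀ μ₀ μ ν * Dstep L M θ μ₀ k x := by
  have hs := shift_coord L M (μ₀ := μ₀) k
  unfold tw sgn2 Dstep
  by_cases hν : ν = ν₀
  · by_cases hμ : μ = ν₀
    · -- `μ = ν`: degenerate plaquette, both sides vanish
      have e : μ = ν := hμ.trans hν.symm
      simp only [e, hν, if_true, true_and, sub_self, zero_mul]
      ring
    · have e2 : (if μ = ν₀ ∧ ν = μ₀ then (1 : ℝ) else 0) = 0 := if_neg (fun h => hμ h.1)
      simp only [if_pos hν, if_neg hμ, e2, sub_zero, zero_add, hs]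
      by_cases h : μ = μ₀
      · rw [if_pos h, if_pos ⟨hν, h⟩]; ring
      · rw [if_neg h, if_neg (fun h' => h h'.2), add_zero]; ring
  · by_cases hμ : μ = ν₀
    · have e1 : (if ν = ν₀ ∧ μ = μ₀ then (1 : ℝ) else 0) = 0 := if_neg (fun h => hν h.1)
      simp only [if_neg hν, if_pos hμ, e1, zero_sub, add_zero, sub_zero, hs]
      by_cases h : ν = μ₀
      · rw [if_pos h, if_pos ⟨hμ, h⟩]; ring
      · rw [if_neg h, if_neg (fun h' => h h'.2), add_zero]; ring
    · have e1 : (if ν = ν₀ ∧ μ = μ₀ then (1 : ℝ) else 0) = 0 := if_neg (fun h => hν h.1)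
      have e2 : (if μ = ν₀ ∧ ν = μ₀ then (1 : ℝ) else 0) = 0 := if_neg (fun h => hμ h.1)
      simp only [if_neg hν, if_neg hμ, e1, e2, sub_self, zero_mul, add_zero]

omit [NeZero L] hM in
/-- **THE PLAQUETTE HOLONOMY OF THE WAVE** is the scalar unitary `exp(iσ_{μν}D_k(x))·1`. [folklore] -/
theorem plaqHol_cwave (k : ℕ) (μ ν : Fin d) (x : Tor (fine (lev L k) M)) :
    plaqHol (fine (lev L k) M) (fun ν x => ((cwave (n := n) L M θ ν₀ μ₀ k ν x : Matrix.unitaryGroup n ℂ) : Matrix n n ℂ)) x μ ν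
      = Complex.exp (Complex.I * ((sgn2 ν₀ μ₀ μ ν * Dstep L M θ μ₀ k x : ℝ) : ℂ)) • (1 : Matrix n n ℂ) := by
  rw [← pang_eq]
  simp only [plaqHol, cwave_coe, cph, cexp_smul_one_inv, Matrix.smul_mul, Matrix.mul_smul, Matrix.one_mul, smul_smul, ← Complex.exp_add]
  congr 1
  congr 1
  push_cast
  ring

omit [NeZero L] hM in
/-- **THE FIELD STRENGTH OF THE WAVE**: `F_k(μ,ν,x) = c_k²·(exp(iσ_{μν}D_k(x)) − 1)·1`. [folklore] -/
theorem Fstr_cwave (k : ℕ) (μ ν : Fin d) (x : Tor (fine (lev L k) M)) :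
    Fstr (fine (lev L k) M) (lev L k) (fun ν x => ((cwave (n := n) L M θ ν₀ μ₀ k ν x : Matrix.unitaryGroup n ℂ) : Matrix n n ℂ)) μ ν x
      = ((((lev L k : ℕ) : ℝ) : ℂ) ^ 2 * (Complex.exp (Complex.I * ((sgn2 ν₀ μ₀ μ ν * Dstep L M θ μ₀ k x : ℝ) : ℂ)) - 1)) • (1 : Matrix n n ℂ) := by
  rw [Fstr, plaqHol_cwave, ← smul_smul, sub_smul, one_smul]

end Plaquette

/-! ## §2 The two-level consistency of the field strength -/

section Consistency

variable (L : ℕ) [NeZero L] (M : Fin d → ℕ) [hM : ∀ μ, NeZero (M μ)] {θ : ℝ} {ν₀ μ₀ : Fin d}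

omit hM in
/-- the angle of a lattice point: `cang m a = cos(ang m a)`, `ang m a = 2π·val(a)/m`; one step `a + 1` adds `2π/m` (for `m ≥ 2`). [folklore] -/
theorem cang_add_one_eq {m : ℕ} [NeZero m] (hm : 2 ≤ m) (a : ZMod m) :
    cang m (a + 1) = Real.cos (2 * π * (a.val : ℝ) / m + 2 * π / m) := by
  have hv1 : (1 : ZMod m).val = 1 := by rw [ZMod.val_one_eq_one_mod]; exact Nat.mod_eq_of_lt (by omega)
  rw [cang_add, hv1]; congr 1; push_cast; ring

/-- **ONE LEVEL**: with `H = 2π/M_{μ₀}`, `α = 2π·val(x_{μ₀})/(c_k M_{μ₀})`, `|σ| ≤ 1`, `|θ| ≤ 1`, `M_{μ₀} ≥ 7`: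
`‖c_k²(e^{iσD_k(x)} − 1) + iσθH·sin α‖ ≤ (|θ| + θ²)H²/c_k` (second-order Taylor of `exp` and `cos`). [folklore] -/
theorem norm_levsq_phase_add_main_le (hθ : |θ| ≤ 1) (hM7 : 7 ≤ M μ₀) {σ : ℝ} (hσ : |σ| ≤ 1) (k : ℕ) (x : Tor (fine (lev L k) M)) :
    ‖(((lev L k : ℕ) : ℝ) : ℂ) ^ 2 * (Complex.exp (Complex.I * ((σ * Dstep L M θ μ₀ k x : ℝ) : ℂ)) - 1)
        + Complex.I * ((σ * θ * (2 * π / (M μ₀ : ℝ)) * Real.sin (2 * π * ((x μ₀).val : ℝ) / ((fine (lev L k) M μ₀ : ℕ) : ℝ)) : ℝ) : ℂ)‖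
      ≤ (|θ| + θ ^ 2) * (2 * π / (M μ₀ : ℝ)) ^ 2 / (lev L k : ℕ) := by
  have hℓ1 : (1 : ℝ) ≤ (lev L k : ℕ) := by exact_mod_cast one_le_lev' L k
  have hℓ : (0 : ℝ) < (lev L k : ℕ) := by linarith
  have hM0 : (0 : ℝ) < (M μ₀ : ℝ) := by exact_mod_cast Nat.pos_of_ne_zero (NeZero.ne (M μ₀))
  have hM7r : (7 : ℝ) ≤ (M μ₀ : ℝ) := by exact_mod_cast hM7
  have hm2 : 2 ≤ fine (lev L k) M μ₀ := le_trans (by omega) (le_trans hM7 (Nat.le_mul_of_pos_left _ (one_le_lev' L k)))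
  have hmR : ((fine (lev L k) M μ₀ : ℕ) : ℝ) = ((lev L k : ℕ) : ℝ) * (M μ₀ : ℝ) := by simp only [fine]; push_cast; ring
  -- names
  set c : ℝ := ((lev L k : ℕ) : ℝ) with hc
  set H : ℝ := 2 * π / (M μ₀ : ℝ) with hH
  set h : ℝ := 2 * π / ((fine (lev L k) M μ₀ : ℕ) : ℝ) with hh
  set α : ℝ := 2 * π * ((x μ₀).val : ℝ) / ((fine (lev L k) M μ₀ : ℕ) : ℝ) with hα
  have hπ := Real.pi_pos
  have hπ4 : π < 4 := Real.pi_lt_four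
  have hHle : H ≤ 1 := by rw [hH, div_le_one hM0]; linarith [Real.pi_lt_d2]
  have hH0 : 0 ≤ H := by positivity
  have hch : c * h = H := by rw [hh, hmR, hH]; field_simp
  have hh0 : 0 ≤ h := by positivity
  have hhle : h ≤ 1 := by
    have : h ≤ H := by
      rw [← hch]; exact le_mul_of_one_le_left hh0 hℓ1
    linarith
  -- `D = (θ/c)(cos(α + h) − cos α)`
  have hD : Dstep L M θ μ₀ k x = θ / c * (Real.cos (α + h) - Real.cos α) := by
    rw [Dstep, cang_add_one_eq hm2]; rfl
  have hcosd : |Real.cos (α + h) - Real.cos α| ≤ h := by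
    refine (Real.abs_cos_sub_cos_le _ _).trans (le_of_eq ?_); rw [show α + h - α = h by ring, abs_of_nonneg hh0]
  have hθ0 := abs_nonneg θ
  have hσ0 := abs_nonneg σ
  -- the exponent `z = iσD` has `‖z‖ ≤ |θ|h/c ≤ 1`
  set z : ℂ := Complex.I * ((σ * Dstep L M θ μ₀ k x : ℝ) : ℂ) with hz
  have hz_norm : ‖z‖ = |σ| * |Dstep L M θ μ₀ k x| := by
    rw [hz, norm_mul, Complex.norm_I, one_mul, Complex.norm_real, Real.norm_eq_abs, abs_mul]
  have hDabs : |Dstep L M θ μ₀ k x| ≤ |θ| / c * h := by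
    rw [hD, abs_mul, abs_div, hc, Nat.abs_cast]; exact mul_le_mul_of_nonneg_left hcosd (by positivity)
  have hz1 : ‖z‖ ≤ 1 := by
    rw [hz_norm]
    calc |σ| * |Dstep L M θ μ₀ k x| ≤ 1 * (|θ| / c * h) := mul_le_mul hσ hDabs (abs_nonneg _) zero_le_one
      _ ≤ 1 * (1 / 1 * 1) := by gcongr
      _ = 1 := by norm_num
  -- second-order Taylor of `exp`
  have hT := Complex.norm_exp_sub_one_sub_id_le hz1
  -- main-term algebra: `c²·z + iσθH sin α = iσ·cθ·(cos(α+h) − cos α + h sin α)`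
  have halg : (c : ℂ) ^ 2 * z + Complex.I * ((σ * θ * H * Real.sin α : ℝ) : ℂ)
      = Complex.I * ((σ * (c * θ) * (Real.cos (α + h) - Real.cos α + h * Real.sin α) : ℝ) : ℂ) := by
    rw [hz, hD, ← hch]; push_cast; field_simp; try ring
  have hmain : ‖(c : ℂ) ^ 2 * z + Complex.I * ((σ * θ * H * Real.sin α : ℝ) : ℂ)‖ ≤ |θ| * H ^ 2 / c := by
    rw [halg, norm_mul, Complex.norm_I, one_mul, Complex.norm_real, Real.norm_eq_abs, abs_mul, abs_mul, abs_mul, hc, Nat.abs_cast]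
    have hq := abs_cos_add_sub_cos_add_mul_sin_le α (show |h| ≤ 1 by rwa [abs_of_nonneg hh0])
    calc |σ| * (((lev L k : ℕ) : ℝ) * |θ|) * |Real.cos (α + h) - Real.cos α + h * Real.sin α| ≤ 1 * (((lev L k : ℕ) : ℝ) * |θ|) * h ^ 2 := by gcongr
      _ = |θ| * H ^ 2 / ((lev L k : ℕ) : ℝ) := by rw [← hch, hc]; field_simp
  -- remainder: `c²‖e^z − 1 − z‖ ≤ c²‖z‖² ≤ θ²h² ... ≤ θ²H²/c`
  have hrem : ‖(c : ℂ) ^ 2 * (Complex.exp z - 1 - z)‖ ≤ θ ^ 2 * H ^ 2 / c := by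
    rw [norm_mul, norm_pow, Complex.norm_real, Real.norm_eq_abs, hc, Nat.abs_cast]
    have h2 : ‖z‖ ^ 2 ≤ (|θ| / ((lev L k : ℕ) : ℝ) * h) ^ 2 := by
      refine pow_le_pow_left₀ (norm_nonneg _) ?_ 2
      rw [hz_norm]
      calc |σ| * |Dstep L M θ μ₀ k x| ≤ 1 * (|θ| / ((lev L k : ℕ) : ℝ) * h) := mul_le_mul hσ (by rw [hc] at hDabs; exact hDabs) (abs_nonneg _) zero_le_one
        _ = _ := one_mul _
    calc ((lev L k : ℕ) : ℝ) ^ 2 * ‖Complex.exp z - 1 - z‖ ≤ ((lev L k : ℕ) : ℝ) ^ 2 * (|θ| / ((lev L k : ℕ) : ℝ) * h) ^ 2 :=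
          mul_le_mul_of_nonneg_left (hT.trans h2) (by positivity)
      _ = θ ^ 2 * H ^ 2 / ((lev L k : ℕ) : ℝ) ^ 2 := by rw [← hch, hc, ← sq_abs θ]; field_simp
      _ ≤ θ ^ 2 * H ^ 2 / ((lev L k : ℕ) : ℝ) := div_le_div_of_nonneg_left (by positivity) hℓ (by nlinarith)
  -- assemble: `c²(e^z − 1) + iσθH sin α = c²(e^z − 1 − z) + (c² z + iσθH sin α)`
  have hsplit : (c : ℂ) ^ 2 * (Complex.exp z - 1) + Complex.I * ((σ * θ * H * Real.sin α : ℝ) : ℂ)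
      = (c : ℂ) ^ 2 * (Complex.exp z - 1 - z) + ((c : ℂ) ^ 2 * z + Complex.I * ((σ * θ * H * Real.sin α : ℝ) : ℂ)) := by ring
  rw [hsplit]
  refine (norm_add_le _ _).trans ?_
  calc ‖(c : ℂ) ^ 2 * (Complex.exp z - 1 - z)‖ + ‖(c : ℂ) ^ 2 * z + Complex.I * ((σ * θ * H * Real.sin α : ℝ) : ℂ)‖
      ≤ θ ^ 2 * H ^ 2 / c + |θ| * H ^ 2 / c := add_le_add hrem hmain
    _ = (|θ| + θ ^ 2) * H ^ 2 / c := by ring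

/-- **THE BLOCK PARENT MOVES THE ANGLE BY LESS THAN ONE COARSE STEP**: `|α_{k+1}(y) − α_k(par y)| ≤ 2π/(c_k M_{μ₀})` (the blocks nest:
`val(par y)_{μ₀} = ⌊val(y_{μ₀})/L⌋`; cf. `LatticeCosineProfile.abs_cang_sub_cang_par_le`). [folklore] -/
theorem abs_angle_sub_angle_par_le (k : ℕ) (y : Tor (fine (lev L (k + 1)) M)) :
    |2 * π * ((y μ₀).val : ℝ) / ((fine (lev L (k + 1)) M μ₀ : ℕ) : ℝ) - 2 * π * (((par (lev L k) L M y) μ₀).val : ℝ) / ((fine (lev L k) M μ₀ : ℕ) : ℝ)|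
      ≤ 2 * π / (((lev L k : ℕ) : ℝ) * (M μ₀ : ℝ)) := by
  have hL : (0 : ℝ) < L := by exact_mod_cast Nat.pos_of_ne_zero (NeZero.ne L)
  have hLn : 0 < L := Nat.pos_of_ne_zero (NeZero.ne L)
  have hℓ : (0 : ℝ) < (lev L k : ℕ) := lev_pos L k
  have hMμ : (0 : ℝ) < (M μ₀ : ℝ) := by exact_mod_cast Nat.pos_of_ne_zero (NeZero.ne (M μ₀))
  set v : ℕ := (y μ₀).val with hv
  have hpar : ((par (lev L k) L M y) μ₀).val = v / L := by rw [val_par, hv]; exact rfl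
  have hqr : ((v % L : ℕ) : ℝ) + (L : ℝ) * ((v / L : ℕ) : ℝ) = (v : ℝ) := by exact_mod_cast Nat.mod_add_div v L
  have hr : ((v % L : ℕ) : ℝ) < L := by exact_mod_cast Nat.mod_lt v hLn
  have hr0 : (0 : ℝ) ≤ ((v % L : ℕ) : ℝ) := Nat.cast_nonneg _
  rw [hpar]
  have e1 : ((fine (lev L (k + 1)) M μ₀ : ℕ) : ℝ) = (L : ℝ) * ((lev L k : ℕ) : ℝ) * (M μ₀ : ℝ) := by
    simp only [fine, lev_succ']; push_cast; ring
  have e2 : ((fine (lev L k) M μ₀ : ℕ) : ℝ) = ((lev L k : ℕ) : ℝ) * (M μ₀ : ℝ) := by simp only [fine]; push_cast; ring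
  rw [e1, e2]
  have e3 : 2 * π * (v : ℝ) / ((L : ℝ) * ((lev L k : ℕ) : ℝ) * (M μ₀ : ℝ)) - 2 * π * ((v / L : ℕ) : ℝ) / (((lev L k : ℕ) : ℝ) * (M μ₀ : ℝ))
      = (2 * π / (((lev L k : ℕ) : ℝ) * (M μ₀ : ℝ))) * (((v % L : ℕ) : ℝ) / L) := by
    rw [← hqr]; field_simp; ring
  rw [e3, abs_of_nonneg (by positivity)]
  calc 2 * π / (((lev L k : ℕ) : ℝ) * (M μ₀ : ℝ)) * (((v % L : ℕ) : ℝ) / L) ≤ 2 * π / (((lev L k : ℕ) : ℝ) * (M μ₀ : ℝ)) * 1 := by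
        refine mul_le_mul_of_nonneg_left ((div_le_one hL).mpr hr.le) (by positivity)
    _ = 2 * π / (((lev L k : ℕ) : ℝ) * (M μ₀ : ℝ)) := mul_one _

/-- **TWO-LEVEL CONSISTENCY OF THE WAVE's PLAQUETTE FACTOR**: `‖c_{k+1}²(e^{iσD_{k+1}(y)} − 1) − c_k²(e^{iσD_k(par y)} − 1)‖ ≤ 4π²(3|θ| + 2θ²)/M_{μ₀}² · c_k⁻¹`. [folklore] -/
theorem norm_levsq_phase_consistent (hθ : |θ| ≤ 1) (hM7 : 7 ≤ M μ₀) {σ : ℝ} (hσ : |σ| ≤ 1) (k : ℕ) (y : Tor (fine (lev L (k + 1)) M)) :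
    ‖(((lev L (k + 1) : ℕ) : ℝ) : ℂ) ^ 2 * (Complex.exp (Complex.I * ((σ * Dstep L M θ μ₀ (k + 1) y : ℝ) : ℂ)) - 1)
        - (((lev L k : ℕ) : ℝ) : ℂ) ^ 2 * (Complex.exp (Complex.I * ((σ * Dstep L M θ μ₀ k (par (lev L k) L M y) : ℝ) : ℂ)) - 1)‖
      ≤ 4 * π ^ 2 * (3 * |θ| + 2 * θ ^ 2) / (M μ₀ : ℝ) ^ 2 / (lev L k : ℕ) := by
  have hℓ1 : (1 : ℝ) ≤ (lev L k : ℕ) := by exact_mod_cast one_le_lev' L k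
  have hℓ : (0 : ℝ) < (lev L k : ℕ) := by linarith
  have hL1 : (1 : ℝ) ≤ L := by exact_mod_cast Nat.pos_of_ne_zero (NeZero.ne L)
  have hM0 : (0 : ℝ) < (M μ₀ : ℝ) := by exact_mod_cast Nat.pos_of_ne_zero (NeZero.ne (M μ₀))
  have hθ0 := abs_nonneg θ
  have hsucc : ((lev L (k + 1) : ℕ) : ℝ) = (L : ℝ) * ((lev L k : ℕ) : ℝ) := by rw [lev_succ']; push_cast; ring
  have hℓ' : ((lev L k : ℕ) : ℝ) ≤ ((lev L (k + 1) : ℕ) : ℝ) := by rw [hsucc]; nlinarith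
  set H : ℝ := 2 * π / (M μ₀ : ℝ) with hH
  set α' : ℝ := 2 * π * ((y μ₀).val : ℝ) / ((fine (lev L (k + 1)) M μ₀ : ℕ) : ℝ) with hα'
  set α : ℝ := 2 * π * (((par (lev L k) L M y) μ₀).val : ℝ) / ((fine (lev L k) M μ₀ : ℕ) : ℝ) with hα
  have E' := norm_levsq_phase_add_main_le L M hθ hM7 hσ (k + 1) y
  have E := norm_levsq_phase_add_main_le L M hθ hM7 hσ k (par (lev L k) L M y)
  have hang := abs_angle_sub_angle_par_le L M (μ₀ := μ₀) k y
  rw [← hH] at E' E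
  rw [← hα'] at E' hang
  rw [← hα] at E hang
  -- the main terms differ by `σθH(sin α' − sin α)`
  set X' : ℂ := (((lev L (k + 1) : ℕ) : ℝ) : ℂ) ^ 2 * (Complex.exp (Complex.I * ((σ * Dstep L M θ μ₀ (k + 1) y : ℝ) : ℂ)) - 1) with hX'
  set X : ℂ := (((lev L k : ℕ) : ℝ) : ℂ) ^ 2 * (Complex.exp (Complex.I * ((σ * Dstep L M θ μ₀ k (par (lev L k) L M y) : ℝ) : ℂ)) - 1) with hX
  have hsplit : X' - X = (X' + Complex.I * ((σ * θ * H * Real.sin α' : ℝ) : ℂ)) - (X + Complex.I * ((σ * θ * H * Real.sin α : ℝ) : ℂ))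
      - Complex.I * ((σ * θ * H * (Real.sin α' - Real.sin α) : ℝ) : ℂ) := by push_cast; ring
  rw [hsplit]
  have hsin : ‖Complex.I * ((σ * θ * H * (Real.sin α' - Real.sin α) : ℝ) : ℂ)‖ ≤ |θ| * H * (2 * π / (((lev L k : ℕ) : ℝ) * (M μ₀ : ℝ))) := by
    rw [norm_mul, Complex.norm_I, one_mul, Complex.norm_real, Real.norm_eq_abs, abs_mul, abs_mul, abs_mul, abs_of_nonneg (by positivity : (0 : ℝ) ≤ H)]
    calc |σ| * |θ| * H * |Real.sin α' - Real.sin α| ≤ 1 * |θ| * H * (2 * π / (((lev L k : ℕ) : ℝ) * (M μ₀ : ℝ))) := by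
          gcongr
          exact (Real.abs_sin_sub_sin_le _ _).trans hang
      _ = _ := by ring
  have hE'2 : (|θ| + θ ^ 2) * H ^ 2 / (lev L (k + 1) : ℕ) ≤ (|θ| + θ ^ 2) * H ^ 2 / (lev L k : ℕ) :=
    div_le_div_of_nonneg_left (by positivity) hℓ hℓ'
  calc ‖(X' + Complex.I * ((σ * θ * H * Real.sin α' : ℝ) : ℂ)) - (X + Complex.I * ((σ * θ * H * Real.sin α : ℝ) : ℂ))
        - Complex.I * ((σ * θ * H * (Real.sin α' - Real.sin α) : ℝ) : ℂ)‖
      ≤ ‖X' + Complex.I * ((σ * θ * H * Real.sin α' : ℝ) : ℂ)‖ + ‖X + Complex.I * ((σ * θ * H * Real.sin α : ℝ) : ℂ)‖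
        + ‖Complex.I * ((σ * θ * H * (Real.sin α' - Real.sin α) : ℝ) : ℂ)‖ :=
          (norm_sub_le _ _).trans (add_le_add (norm_sub_le _ _) le_rfl)
    _ ≤ (|θ| + θ ^ 2) * H ^ 2 / (lev L k : ℕ) + (|θ| + θ ^ 2) * H ^ 2 / (lev L k : ℕ) + |θ| * H * (2 * π / (((lev L k : ℕ) : ℝ) * (M μ₀ : ℝ))) :=
          add_le_add (add_le_add (E'.trans hE'2) E) hsin
    _ = 4 * π ^ 2 * (3 * |θ| + 2 * θ ^ 2) / (M μ₀ : ℝ) ^ 2 / (lev L k : ℕ) := by rw [hH]; field_simp; ring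

/-- **(Fc) FOR THE WAVE**: `‖F_{k+1}(μ,ν,y) − F_k(μ,ν,par y)‖ ≤ 4π²(3|θ| + 2θ²)/M_{μ₀}² · c_k⁻¹` for `|θ| ≤ 1`, `M_{μ₀} ≥ 7`. [folklore] -/
theorem Fstr_cwave_consistent [Nonempty n] (hθ : |θ| ≤ 1) (hM7 : 7 ≤ M μ₀) (k : ℕ) (μ ν : Fin d) (y : Tor (fine (lev L (k + 1)) M)) :
    ‖Fstr (fine (lev L (k + 1)) M) (lev L (k + 1)) (fun ν x => ((cwave (n := n) L M θ ν₀ μ₀ (k + 1) ν x : Matrix.unitaryGroup n ℂ) : Matrix n n ℂ)) μ ν y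
        - Fstr (fine (lev L k) M) (lev L k) (fun ν x => ((cwave (n := n) L M θ ν₀ μ₀ k ν x : Matrix.unitaryGroup n ℂ) : Matrix n n ℂ)) μ ν (par (lev L k) L M y)‖
      ≤ 4 * π ^ 2 * (3 * |θ| + 2 * θ ^ 2) / (M μ₀ : ℝ) ^ 2 / (lev L k : ℕ) := by
  rw [Fstr_cwave, Fstr_cwave, ← sub_smul, norm_smul_one_eq]
  exact norm_levsq_phase_consistent L M hθ hM7 (abs_sgn2_le ν₀ μ₀ μ ν) k y

end Consistency

end Summit.QuantumFields.BalabanUV.T4Continuum.NE2.RegularGaugeFieldWaveCurvature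

end
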